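import Summits.BirchSwinnertonDyer.BirchSwinnertonDyer.Theorems.ByReductionTypeAtTwoMultUpperHalfTowerFiltAddv3
import Summits.BirchSwinnertonDyer.BirchSwinnertonDyer.Theorems.ByReductionTypeAtTwoMultUpperHalfTowerCertAddv2
import HarnessLib

/-!
# Route `ByReductionTypeAtTwo`, crux `MultUpperHalfAtTwo` (item stmt-BirchSwinnertonDyer-19922): the TWO-LAYER tower-gap doors of the
# `E[2]`-irreducible habitat with a SEVENTH per-prime disjunct «ADDITIVE with `ord_ℓ(Δ_min)` ODD ⟹ ONE bit» (seat bsd-2adic-mult-2 GEN 10, part 3 of the doors)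

HONEST FRAMING (cell `bsd-2adic`, run/shared/lean/pub/bsd-2adic/, HUMAN RULINGS D-0036 / D-0054 / D-0074 row (A)): research route; THEOREMS
ONLY — no definition, no new named fact; nothing is booked; BSD is not proved by any of this. PARTITION: X5@2 mult (K4ᵐ, B1·O1) × p = 2 —
types-the-object-of; closes none.

WHAT. GEN 8's `MultTowerAddv.towerGapAtTwo_of_layerSelmer_{numeric,nat,cert}_atTwo_addv2` (`…MultUpperHalfTowerCertAddv2`, p510658) VERBATIM with
the per-prime disjunction `hC` extended by the SEVENTH disjunct of `…MultUpperHalfTowerFiltAddv3` (this seat): at an odd prime `ℓ` with `ℓ ∣ c₄`,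
`ℓ^{k_ℓ} ∥ Δ_min`, `2 ∤ k_ℓ` — ADDITIVE with `ord_ℓ(Δ_min)` odd (Kodaira `I_n*` `n` odd, `III`, `III*`) — the local tower kernel is CYCLIC at every layer
(`MultTowerOddOrd.pTorsion_le_two_of_additive_of_odd_ord`), so `C_ℓ = 2` is admissible (ONE bit). Two layer counts `2^a ≤ #Sel_{2^∞}(E/ℚ_j)[2]`,
`#Sel_{2^∞}(E/ℚ_{j'})[2] ≤ 2^d`; the binder-free habitats at `v ∣ 2` follow in `…MultUpperHalfTowerKernelDoorsAddv3`.

DISPLAYED, NOT PROVED: PRINT {`h33g`, `hM`, `hA`} (tree theorems `…_holds`), the displayed bound `h2` at `v ∣ 2`; CERTIFICATES (layer counts).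
∀-LEVEL CONTENT: none.

References: Greenberg LNM 1716 §3; Silverman *AEC* VII.1/5.1/6.1, *ATAEC* IV.9 Table 4.1; Washington §13.1.
-/

set_option autoImplicit false
-- the Theorems namespace of this sub repeats the summit name by design (D-0017 nested layout: Summit.<S>.<Sub>)
set_option linter.dupNamespace false

noncomputable section

open scoped Classical MatrixGroups ModularForm

open NumberField IsDedekindDomain CongruenceSubgroup WeierstrassCurve Literature.NumberTheory.EllipticCurves
  Literature.NumberTheory.EllipticCurves.ModularForms
  Literature.NumberTheory.EllipticCurves.Greenberg1999
  Literature.NumberTheory.EllipticCurves.Rank1Residual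
  Literature.NumberTheory.EllipticCurves.Rank1Residual.Typed
  Literature.NumberTheory.GaloisRepresentations
  Summit.BirchSwinnertonDyer.Rank1Residual.X5 Summit.BirchSwinnertonDyer.Rank1Residual.X5.O1
  Summit.BirchSwinnertonDyer.Rank1Residual.X5.TowerGap
  Summit.BirchSwinnertonDyer.Rank1Residual
  Summit.BirchSwinnertonDyer.BirchSwinnertonDyer.Theorems.KatoHalfPinch
  Rat.HeightOneSpectrum

namespace Summit.BirchSwinnertonDyer.BirchSwinnertonDyer.Theorems.MultTowerAddv

/-! ## The two-layer gap certificate with the constant at `2` a datum, SEVEN disjuncts -/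

section Gap

variable (W : WeierstrassCurve ℚ) [W.IsElliptic] [W.IsGloballyMinimal]

omit [W.IsGloballyMinimal] in
/-- **The GAP certificate with NUMERIC local constants, the constant at `2` a DATUM, SEVEN disjuncts.** `W/ℚ` with odd torsion order
(ANY reduction type at `2`); layers `j ≤ j'`; `S` a finite set of finite places off which every place is odd and good; PRINT `h33g`,
`hM`, `hA`; a displayed bound `h2` at the place(s) over `2` by `C₂`; numeric constants `C_v` at the odd `v ∈ S` justified by ONE of FIVE
disjuncts (the fifth: additive with odd `c̄_v`, `1 ≤ C_v`); layer counts; arithmetic as in `MultTowerCert.…_numeric_atTwo`. Then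
`O1.TowerGapAtTwo W`. [cite: GreenbergLNM1716, §3 Lemmas 3.3–3.5 (PDF pp. 86–90) and pp. 90–93] [cite: SilvermanATAEC1994, IV.9 Table 4.1] -/
theorem towerGapAtTwo_of_layerSelmer_numeric_atTwo_addv3
    (h33g : lemma33_localTowerKerPrimary_eq_bot_of_good.{0})
    (hM : lemma33_localTowerKerPrimary_cyclic_of_multiplicative.{0})
    (hA : lemma33_natCard_localTowerKerPrimary_le_four_of_additive.{0})
    (htors : ¬ 2 ∣ W.torsionOrder) {j j' a d : ℕ} (hjj' : j ≤ j') (C₂ : ℕ)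
    (h2 : ∀ κ : ZpExtension ℚ 2, κ.IsCyclotomic → ∀ v : HeightOneSpectrum (𝓞 ℚ),
      ((2 : ℕ) : 𝓞 ℚ) ∈ v.asIdeal →
        Finite {x : W.localTowerKerPrimary κ (v.adicCompletion ℚ) j' // 2 • x = 0} ∧
          Nat.card {x : W.localTowerKerPrimary κ (v.adicCompletion ℚ) j' // 2 • x = 0} ≤ C₂)
    (S : Finset (HeightOneSpectrum (𝓞 ℚ)))
    (hS : ∀ v ∉ S, ((2 : ℕ) : 𝓞 ℚ) ∉ v.asIdeal ∧ W.HasGoodReductionAt v)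
    (C : HeightOneSpectrum (𝓞 ℚ) → ℕ)
    (hC : ∀ v ∈ S, ((2 : ℕ) : 𝓞 ℚ) ∉ v.asIdeal →
      4 ≤ C v ∨ (W.HasMultiplicativeReductionAt v ∧ 2 ≤ C v) ∨
        (W.HasMultiplicativeReductionAt v ∧ ¬ 2 ∣ W.ordMinimalDiscriminant v ∧ 1 ≤ C v) ∨
        (W.HasGoodReductionAt v ∧ 1 ≤ C v) ∨
        (W.HasAdditiveReductionAt v ∧ ¬ 2 ∣ (W.kodairaSymbolAt v).componentGroupOrder ∧ 1 ≤ C v) ∨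
        (W.HasAdditiveReductionAt v ∧ (∀ m, W.kodairaSymbolAt v ≠ .Istar m) ∧ 2 ≤ C v) ∨
        (W.HasAdditiveReductionAt v ∧ ¬ 2 ∣ W.ordMinimalDiscriminant v ∧ 2 ≤ C v))
    (hlow : ∀ κ : ZpExtension ℚ 2, κ.IsCyclotomic →
      2 ^ a ≤ Nat.card {z : W.selmerLayer κ j // 2 • z = 0})
    (hup : ∀ κ : ZpExtension ℚ 2, κ.IsCyclotomic →
      Nat.card {z : W.selmerLayer κ j' // 2 • z = 0} ≤ 2 ^ d)
    (harith : 2 ^ d * ∏ v ∈ S, (if ((2 : ℕ) : 𝓞 ℚ) ∈ v.asIdeal then C₂ else C v) ^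
        (if ((2 : ℕ) : 𝓞 ℚ) ∈ v.asIdeal then 1
          else 2 ^ min j' (padicValNat 2 (natGenerator v ^ 2 - 1) - 3)) <
      2 ^ (2 ^ j' - 2 ^ j + a)) : TowerGapAtTwo W := by
  refine towerGapAtTwo_of_localKernelBounds_sharp W htors hjj' S
    (fun v ↦ if ((2 : ℕ) : 𝓞 ℚ) ∈ v.asIdeal then C₂ else C v) hlow hup
    (fun κ hκ v hv ↦ h33g ℚ W 2 κ hκ v (hS v hv).1 (hS v hv).2 j') (fun κ hκ v hv ↦ ?_) harith
  by_cases h2v : ((2 : ℕ) : 𝓞 ℚ) ∈ v.asIdeal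
  · rw [if_pos h2v]
    exact h2 κ hκ v h2v
  · rw [if_neg h2v]
    exact pTorsion_localTowerKer_le_of_numeric_addv3 W h33g hM hA κ hκ v h2v j' (C v) (hC v hv h2v)


/-- **The GAP certificate indexed by rational primes, the constant at `2` a DATUM, SEVEN disjuncts.** `P` a finite set of ODD primes
containing every odd prime of the minimal discriminant, `C : ℕ → ℕ` justified per `ℓ ∈ P` by one of seven disjuncts — the fifth being
the PARITY CERTIFICATE of `…MultTowerLocalAddv` (`ℓ ∣ c₄`, `ℓ^k ∥ Δ_min`, `k ∈ {2,4,5} ∨ (7 ≤ k ≠ 9 ∧ ℓ^k ∣ c₄³)`, `1 ≤ C ℓ`);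
arithmetic `2^d · C₂ · ∏_{ℓ ∈ P} C_ℓ^{2^{min(j', v₂(ℓ² − 1) − 3)}} < 2^{2^{j'} − 2^j + a}`.
[cite: GreenbergLNM1716, §3 Lemmas 3.3–3.5 (PDF pp. 86–90) and pp. 90–93] [cite: SilvermanAEC2009, VII.1 Prop. 1.3, VII.5.1] -/
theorem towerGapAtTwo_of_layerSelmer_nat_atTwo_addv3
    (h33g : lemma33_localTowerKerPrimary_eq_bot_of_good.{0})
    (hM : lemma33_localTowerKerPrimary_cyclic_of_multiplicative.{0})
    (hA : lemma33_natCard_localTowerKerPrimary_le_four_of_additive.{0})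
    (htors : ¬ 2 ∣ W.torsionOrder) {j j' a d : ℕ} (hjj' : j ≤ j') (C₂ : ℕ)
    (h2 : ∀ κ : ZpExtension ℚ 2, κ.IsCyclotomic → ∀ v : HeightOneSpectrum (𝓞 ℚ),
      ((2 : ℕ) : 𝓞 ℚ) ∈ v.asIdeal →
        Finite {x : W.localTowerKerPrimary κ (v.adicCompletion ℚ) j' // 2 • x = 0} ∧
          Nat.card {x : W.localTowerKerPrimary κ (v.adicCompletion ℚ) j' // 2 • x = 0} ≤ C₂)
    (P : Finset ℕ) (hP : ∀ ℓ ∈ P, ℓ.Prime ∧ ℓ ≠ 2)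
    (hΔ : ∀ ℓ : ℕ, ℓ.Prime → ℓ ≠ 2 → (ℓ : ℤ) ∣ W.minimalDiscriminantInt → ℓ ∈ P)
    (C : ℕ → ℕ)
    (hC : ∀ (ℓ : ℕ) [Fact ℓ.Prime], ℓ ∈ P →
      4 ≤ C ℓ ∨ (W.HasMultiplicativeReductionAtPrime ℓ ∧ 2 ≤ C ℓ) ∨
        (W.HasMultiplicativeReductionAtPrime ℓ ∧ ¬ 2 ∣ padicValInt ℓ W.minimalDiscriminantInt ∧
          1 ≤ C ℓ) ∨
        (¬ (ℓ : ℤ) ∣ W.minimalDiscriminantInt ∧ 1 ≤ C ℓ) ∨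
        ((∃ k : ℕ, (ℓ : ℤ) ∣ (integralModelInt W).c₄ ∧ (ℓ : ℤ) ^ k ∣ W.minimalDiscriminantInt ∧
            ¬ (ℓ : ℤ) ^ (k + 1) ∣ W.minimalDiscriminantInt ∧
            (k = 2 ∨ k = 4 ∨ k = 5 ∨ (7 ≤ k ∧ k ≠ 9 ∧ (ℓ : ℤ) ^ k ∣ (integralModelInt W).c₄ ^ 3))) ∧ 1 ≤ C ℓ) ∨
        ((∃ k : ℕ, (ℓ : ℤ) ∣ (integralModelInt W).c₄ ∧ (ℓ : ℤ) ^ k ∣ W.minimalDiscriminantInt ∧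
            ¬ (ℓ : ℤ) ^ (k + 1) ∣ W.minimalDiscriminantInt ∧ 1 ≤ k ∧ k ≠ 6 ∧ (ℓ : ℤ) ^ k ∣ (integralModelInt W).c₄ ^ 3) ∧ 2 ≤ C ℓ) ∨
        ((∃ k : ℕ, (ℓ : ℤ) ∣ (integralModelInt W).c₄ ∧ (ℓ : ℤ) ^ k ∣ W.minimalDiscriminantInt ∧
            ¬ (ℓ : ℤ) ^ (k + 1) ∣ W.minimalDiscriminantInt ∧ ¬ 2 ∣ k) ∧ 2 ≤ C ℓ))
    (hlow : ∀ κ : ZpExtension ℚ 2, κ.IsCyclotomic →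
      2 ^ a ≤ Nat.card {z : W.selmerLayer κ j // 2 • z = 0})
    (hup : ∀ κ : ZpExtension ℚ 2, κ.IsCyclotomic →
      Nat.card {z : W.selmerLayer κ j' // 2 • z = 0} ≤ 2 ^ d)
    (harith : 2 ^ d * C₂ * ∏ ℓ ∈ P, C ℓ ^ 2 ^ min j' (padicValNat 2 (ℓ ^ 2 - 1) - 3) <
      2 ^ (2 ^ j' - 2 ^ j + a)) : TowerGapAtTwo W := by
  -- the places (exactly as in tower-1 part 8 / GEN 4)
  let pl : ℕ → HeightOneSpectrum (𝓞 ℚ) := fun ℓ ↦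
    if h : ℓ.Prime then (primesEquiv (R := 𝓞 ℚ)).symm ⟨ℓ, h⟩
      else (primesEquiv (R := 𝓞 ℚ)).symm ⟨2, Nat.prime_two⟩
  have hpl : ∀ {ℓ : ℕ}, ℓ.Prime → natGenerator (pl ℓ) = ℓ := fun {ℓ} h ↦ by
    simp only [pl, dif_pos h]
    exact congrArg Subtype.val ((primesEquiv (R := 𝓞 ℚ)).apply_symm_apply ⟨ℓ, h⟩)
  have hpl_inj : Set.InjOn pl P := by
    intro ℓ hℓ ℓ' hℓ' h
    have := congrArg natGenerator h
    rwa [hpl (hP ℓ hℓ).1, hpl (hP ℓ' hℓ').1] at this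
  let v₂ : HeightOneSpectrum (𝓞 ℚ) := pl 2
  have hv₂ : natGenerator v₂ = 2 := hpl Nat.prime_two
  have h2v₂ : ((2 : ℕ) : 𝓞 ℚ) ∈ v₂.asIdeal := (natCast_prime_mem_asIdeal_iff v₂ Nat.prime_two).mpr hv₂
  have hv₂_notMem : v₂ ∉ P.image pl := by
    intro h
    obtain ⟨ℓ, hℓ, hℓeq⟩ := Finset.mem_image.mp h
    have := congrArg natGenerator hℓeq
    rw [hpl (hP ℓ hℓ).1, hv₂] at this
    exact (hP ℓ hℓ).2 this
  -- odd places in the image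
  have hodd : ∀ {ℓ : ℕ}, ℓ ∈ P → ((2 : ℕ) : 𝓞 ℚ) ∉ (pl ℓ).asIdeal := fun {ℓ} hℓ h ↦ by
    rw [natCast_prime_mem_asIdeal_iff _ Nat.prime_two, hpl (hP ℓ hℓ).1] at h
    exact (hP ℓ hℓ).2 h
  let S : Finset (HeightOneSpectrum (𝓞 ℚ)) := insert v₂ (P.image pl)
  let Cv : HeightOneSpectrum (𝓞 ℚ) → ℕ := fun v ↦ C (natGenerator v)
  refine towerGapAtTwo_of_layerSelmer_numeric_atTwo_addv3 W h33g hM hA htors hjj' C₂ h2 S ?_ Cv ?_ hlow hup ?_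
  · -- `hS`: off `S` every place is odd and good
    intro v hv
    have hgen := prime_natGenerator v
    haveI : Fact (natGenerator v).Prime := ⟨hgen⟩
    have hvpl : pl (natGenerator v) = v := by
      simp only [pl, dif_pos hgen]
      exact (primesEquiv (R := 𝓞 ℚ)).symm_apply_apply v
    have hne2 : natGenerator v ≠ 2 := by
      intro h
      apply hv
      rw [Finset.mem_insert]
      left
      rw [← hvpl]
      simp only [v₂, h]
    have hnotP : natGenerator v ∉ P := by
      intro h
      exact hv (Finset.mem_insert_of_mem (Finset.mem_image.mpr ⟨_, h, hvpl⟩))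
    refine ⟨fun h ↦ hne2 ((natCast_prime_mem_asIdeal_iff v Nat.prime_two).mp h), ?_⟩
    have hndvd : ¬ ((natGenerator v : ℕ) : ℤ) ∣ W.minimalDiscriminantInt :=
      fun h ↦ hnotP (hΔ _ hgen hne2 h)
    exact (hasGoodReductionAtPrime_iff_hasGoodReductionAt_ringOfIntegers (v := v) W).mp
      (hasGoodReductionAtPrime_of_not_dvd W (natGenerator v) hndvd)
  · -- `hC`: the numeric local constants at the odd places of `S`
    intro v hv h2
    rcases Finset.mem_insert.mp hv with rfl | hv'
    · exact absurd h2v₂ h2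
    obtain ⟨ℓ, hℓP, rfl⟩ := Finset.mem_image.mp hv'
    have hℓ := (hP ℓ hℓP).1
    haveI : Fact ℓ.Prime := ⟨hℓ⟩
    have hgen : natGenerator (pl ℓ) = ℓ := hpl hℓ
    haveI : Fact (Nat.Prime ((primesEquiv (pl ℓ) : Nat.Primes) : ℕ)) := ⟨(primesEquiv (pl ℓ)).2⟩
    have hpe : ((primesEquiv (pl ℓ) : Nat.Primes) : ℕ) = ℓ := hgen
    have hCv : Cv (pl ℓ) = C ℓ := by simp only [Cv, hgen]
    rw [hCv]
    rcases hC ℓ hℓP with h4 | ⟨hm, h2C⟩ | ⟨hm, hord, h1⟩ | ⟨hg, h1⟩ | ⟨⟨k, hc₄, hk, hk', hcases⟩, h1⟩ |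
        ⟨⟨k, hc₄, hk, hk', hk1, hk6, hj⟩, h2C⟩ | ⟨⟨k, hc₄, hk, hk', hko⟩, h2C⟩
    · exact Or.inl h4
    · refine Or.inr (Or.inl ⟨?_, h2C⟩)
      exact (hasMultiplicativeReductionAtPrime_iff_hasMultiplicativeReductionAt_ringOfIntegers
        (W := W) (pl ℓ)).mp ((hasMultiplicativeReductionAtPrime_congr W hpe).mpr hm)
    · refine Or.inr (Or.inr (Or.inl ⟨?_, ?_, h1⟩))
      · exact (hasMultiplicativeReductionAtPrime_iff_hasMultiplicativeReductionAt_ringOfIntegers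
          (W := W) (pl ℓ)).mp ((hasMultiplicativeReductionAtPrime_congr W hpe).mpr hm)
      · rwa [LocalTorsionMult.ordMinimalDiscriminant_eq_padicValInt W (pl ℓ) hpe]
    · refine Or.inr (Or.inr (Or.inr (Or.inl ⟨?_, h1⟩)))
      exact (hasGoodReductionAtPrime_iff_hasGoodReductionAt_ringOfIntegers (v := pl ℓ) W).mp
        ((hasGoodReductionAtPrime_congr W hpe).mpr (hasGoodReductionAtPrime_of_not_dvd W ℓ hg))
    · refine Or.inr (Or.inr (Or.inr (Or.inr (Or.inl ⟨?_, ?_, h1⟩))))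
      · exact (hasAdditiveReductionAt_and_not_two_dvd_componentGroupOrder_of_cert W (pl ℓ) hpe (hP ℓ hℓP).2
          hc₄ hk hk' hcases).1
      · exact (hasAdditiveReductionAt_and_not_two_dvd_componentGroupOrder_of_cert W (pl ℓ) hpe (hP ℓ hℓP).2
          hc₄ hk hk' hcases).2
    · refine Or.inr (Or.inr (Or.inr (Or.inr (Or.inr (Or.inl ⟨?_, ?_, h2C⟩)))))
      · exact (hasAdditiveReductionAt_and_ne_Istar_of_cert W (pl ℓ) hpe (hP ℓ hℓP).2 hc₄ hk hk' hk1 hk6 hj).1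
      · exact (hasAdditiveReductionAt_and_ne_Istar_of_cert W (pl ℓ) hpe (hP ℓ hℓP).2 hc₄ hk hk' hk1 hk6 hj).2
    · refine Or.inr (Or.inr (Or.inr (Or.inr (Or.inr (Or.inr ⟨?_, ?_, h2C⟩)))))
      · exact (hasAdditiveReductionAt_and_odd_ord_of_cert W (pl ℓ) hpe hc₄ hk hk' hko).1
      · rw [LocalTorsionMult.ordMinimalDiscriminant_eq_padicValInt W (pl ℓ) hpe, padicValInt_eq_of_dvd_of_not_dvd hk hk']
        exact hko
  · -- the arithmetic, re-indexed by primes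
    have hprod : ∏ v ∈ S, (if ((2 : ℕ) : 𝓞 ℚ) ∈ v.asIdeal then C₂ else Cv v) ^
        (if ((2 : ℕ) : 𝓞 ℚ) ∈ v.asIdeal then 1
          else 2 ^ min j' (padicValNat 2 (natGenerator v ^ 2 - 1) - 3)) =
        C₂ * ∏ ℓ ∈ P, C ℓ ^ 2 ^ min j' (padicValNat 2 (ℓ ^ 2 - 1) - 3) := by
      rw [Finset.prod_insert hv₂_notMem, if_pos h2v₂, if_pos h2v₂, pow_one,
        Finset.prod_image hpl_inj]
      congr 1
      refine Finset.prod_congr rfl fun ℓ hℓ ↦ ?_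
      rw [if_neg (hodd hℓ), if_neg (hodd hℓ)]
      simp only [Cv, hpl (hP ℓ hℓ).1]
    rw [hprod, ← mul_assoc]
    exact harith


/-- **The GAP certificate, every kernel-side datum decidable, the constant at `2` a DATUM, SEVEN disjuncts.** As GEN 4's
`MultTowerCert.towerGapAtTwo_of_layerSelmer_cert_atTwo` with the fifth disjunct `ℓ ∣ c₄ ∧ ℓ^{k_ℓ} ∥ Δ_min ∧ (k_ℓ ∈ {2,4,5} ∨ (7 ≤ k_ℓ ∧
k_ℓ ≠ 9 ∧ ℓ^{k_ℓ} ∣ c₄³)) ∧ 1 ≤ C_ℓ` (additive of type `II`/`IV`/`IV*`/`II*`: ZERO bits); arithmetic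
`2^d · C₂ · ∏_{ℓ ∈ P} C_ℓ^{2^{min(j', e_ℓ)}} < 2^{2^{j'} − 2^j + a}`.
[cite: GreenbergLNM1716, §3 Lemmas 3.3–3.5 (PDF pp. 86–90) and pp. 90–93] [cite: SilvermanATAEC1994, IV.9 Table 4.1] -/
theorem towerGapAtTwo_of_layerSelmer_cert_atTwo_addv3
    (h33g : lemma33_localTowerKerPrimary_eq_bot_of_good.{0})
    (hM : lemma33_localTowerKerPrimary_cyclic_of_multiplicative.{0})
    (hA : lemma33_natCard_localTowerKerPrimary_le_four_of_additive.{0})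
    (htors : ¬ 2 ∣ W.torsionOrder) {j j' a d : ℕ} (hjj' : j ≤ j') (C₂ : ℕ)
    (h2 : ∀ κ : ZpExtension ℚ 2, κ.IsCyclotomic → ∀ v : HeightOneSpectrum (𝓞 ℚ),
      ((2 : ℕ) : 𝓞 ℚ) ∈ v.asIdeal →
        Finite {x : W.localTowerKerPrimary κ (v.adicCompletion ℚ) j' // 2 • x = 0} ∧
          Nat.card {x : W.localTowerKerPrimary κ (v.adicCompletion ℚ) j' // 2 • x = 0} ≤ C₂)
    (P : Finset ℕ) (hP : ∀ ℓ ∈ P, ℓ.Prime ∧ ℓ ≠ 2)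
    (hΔ : ∀ ℓ : ℕ, ℓ.Prime → ℓ ≠ 2 → (ℓ : ℤ) ∣ W.minimalDiscriminantInt → ℓ ∈ P)
    (C e k : ℕ → ℕ) (he : ∀ ℓ ∈ P, ¬ 2 ^ (e ℓ + 4) ∣ ℓ ^ 2 - 1)
    (hC : ∀ (ℓ : ℕ) [Fact ℓ.Prime], ℓ ∈ P →
      4 ≤ C ℓ ∨ (W.HasMultiplicativeReductionAtPrime ℓ ∧ 2 ≤ C ℓ) ∨
        (W.HasMultiplicativeReductionAtPrime ℓ ∧ (ℓ : ℤ) ^ k ℓ ∣ W.minimalDiscriminantInt ∧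
          ¬ (ℓ : ℤ) ^ (k ℓ + 1) ∣ W.minimalDiscriminantInt ∧ ¬ 2 ∣ k ℓ ∧ 1 ≤ C ℓ) ∨
        (¬ (ℓ : ℤ) ∣ W.minimalDiscriminantInt ∧ 1 ≤ C ℓ) ∨
        ((ℓ : ℤ) ∣ (integralModelInt W).c₄ ∧ (ℓ : ℤ) ^ k ℓ ∣ W.minimalDiscriminantInt ∧
          ¬ (ℓ : ℤ) ^ (k ℓ + 1) ∣ W.minimalDiscriminantInt ∧
          (k ℓ = 2 ∨ k ℓ = 4 ∨ k ℓ = 5 ∨ (7 ≤ k ℓ ∧ k ℓ ≠ 9 ∧ (ℓ : ℤ) ^ k ℓ ∣ (integralModelInt W).c₄ ^ 3)) ∧ 1 ≤ C ℓ) ∨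
        ((ℓ : ℤ) ∣ (integralModelInt W).c₄ ∧ (ℓ : ℤ) ^ k ℓ ∣ W.minimalDiscriminantInt ∧
          ¬ (ℓ : ℤ) ^ (k ℓ + 1) ∣ W.minimalDiscriminantInt ∧ 1 ≤ k ℓ ∧ k ℓ ≠ 6 ∧
          (ℓ : ℤ) ^ k ℓ ∣ (integralModelInt W).c₄ ^ 3 ∧ 2 ≤ C ℓ) ∨
        ((ℓ : ℤ) ∣ (integralModelInt W).c₄ ∧ (ℓ : ℤ) ^ k ℓ ∣ W.minimalDiscriminantInt ∧
          ¬ (ℓ : ℤ) ^ (k ℓ + 1) ∣ W.minimalDiscriminantInt ∧ ¬ 2 ∣ k ℓ ∧ 2 ≤ C ℓ))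
    (hlow : ∀ κ : ZpExtension ℚ 2, κ.IsCyclotomic →
      2 ^ a ≤ Nat.card {z : W.selmerLayer κ j // 2 • z = 0})
    (hup : ∀ κ : ZpExtension ℚ 2, κ.IsCyclotomic →
      Nat.card {z : W.selmerLayer κ j' // 2 • z = 0} ≤ 2 ^ d)
    (harith : 2 ^ d * C₂ * ∏ ℓ ∈ P, C ℓ ^ 2 ^ min j' (e ℓ) < 2 ^ (2 ^ j' - 2 ^ j + a)) :
    TowerGapAtTwo W := by
  -- `1 ≤ C ℓ` on `P`
  have hC1 : ∀ ℓ ∈ P, 1 ≤ C ℓ := by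
    intro ℓ hℓ
    haveI : Fact ℓ.Prime := ⟨(hP ℓ hℓ).1⟩
    rcases hC ℓ hℓ with h | ⟨-, h⟩ | ⟨-, -, -, -, h⟩ | ⟨-, h⟩ | ⟨-, -, -, -, h⟩ | ⟨-, -, -, -, -, -, h⟩ |
        ⟨-, -, -, -, h⟩ <;> omega
  refine towerGapAtTwo_of_layerSelmer_nat_atTwo_addv3 W h33g hM hA htors hjj' C₂ h2 P hP hΔ C
    (fun ℓ _ hℓ ↦ ?_) hlow hup (lt_of_le_of_lt ?_ harith)
  · rcases hC ℓ hℓ with h | h | ⟨hm, h1, h2', hodd, hC'⟩ | h | ⟨hc₄, h1, h2', hcases, hC'⟩ | ⟨hc₄, h1, h2', hk1, hk6, hj, hC'⟩ |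
        ⟨hc₄, h1, h2', hko, hC'⟩
    · exact Or.inl h
    · exact Or.inr (Or.inl h)
    · refine Or.inr (Or.inr (Or.inl ⟨hm, ?_, hC'⟩))
      rwa [padicValInt_eq_of_dvd_of_not_dvd h1 h2']
    · exact Or.inr (Or.inr (Or.inr (Or.inl h)))
    · exact Or.inr (Or.inr (Or.inr (Or.inr (Or.inl ⟨⟨k ℓ, hc₄, h1, h2', hcases⟩, hC'⟩))))
    · exact Or.inr (Or.inr (Or.inr (Or.inr (Or.inr (Or.inl ⟨⟨k ℓ, hc₄, h1, h2', hk1, hk6, hj⟩, hC'⟩)))))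
    · exact Or.inr (Or.inr (Or.inr (Or.inr (Or.inr (Or.inr ⟨⟨k ℓ, hc₄, h1, h2', hko⟩, hC'⟩)))))
  · refine Nat.mul_le_mul_left _ (Finset.prod_le_prod (fun ℓ _ ↦ Nat.zero_le _) fun ℓ hℓ ↦ ?_)
    refine Nat.pow_le_pow_right (hC1 ℓ hℓ) (Nat.pow_le_pow_right (by norm_num) ?_)
    have hℓ2 : ℓ ^ 2 - 1 ≠ 0 := by
      have h3 : 2 ≤ ℓ := (hP ℓ hℓ).1.two_le
      have : 4 ≤ ℓ ^ 2 := by nlinarith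
      omega
    exact min_le_min_left _ (padicValNat_sq_sub_one_sub_three_le hℓ2 (he ℓ hℓ))


end Gap

end Summit.BirchSwinnertonDyer.BirchSwinnertonDyer.Theorems.MultTowerAddv

end
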